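import Literature.NumberTheory.LFunctions.WeilMellinInversion
import Mathlib.Analysis.PSeries
import Mathlib.Algebra.Order.Round
import HarnessLib

/-!
# Decay of every polynomial order of the Weil transform `ĝ` on vertical strips; unit-window summability

Sibling of `Literature/NumberTheory/LFunctions/WeilMellinInversion.lean` and
`WeilExplicitRightEdge.lean` (normalisation `ĝ(s) = ∫ g(t) e^{(s - 1/2)t} dt`,
`Literature.NumberTheory.LFunctions.weilMellin`). Everything here is PROVED; there are no
definitions and no named facts.

* `norm_weilMellin_le_pow_of_abs_re_le` — for a Weil test function `g`, every half-width `A` and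
  every `k : ℕ` there is `D ≥ 0` with `‖ĝ(s)‖ ≤ D/(1 + (Im s)²)^k` on the strip `|Re s - 1/2| ≤ A`
  (induction on `k`: `2k` integrations by parts, `(g'')^(s) = (s - 1/2)² ĝ(s)` and
  `(Im s)² ≤ |s - 1/2|²`; Bombieri §2: "`f̃` is rapidly decreasing on any vertical line").
* `summable_of_unit_window_ncard_le` — the bookkeeping half of every "the sum over the zeros
  converges absolutely" argument: if a real family `γ_i` has finitely many, and at most
  `C (2 + |m|)^A`, members in each unit window `|γ_i - m| ≤ 1` (`m ∈ ℤ`), then `Σ_i F(i) < ∞`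
  whenever `0 ≤ F(i) ≤ D/(1 + γ_i²)^{k+1}` with `A ≤ k` (regroup over the fibres of
  `m = round γ_i` and compare with `Σ_m 1/(1 + m²)`, `WeilMellinPolyDecay.summable_inv_one_add_sq`).

## References

* E. Bombieri, *Remarks on Weil's quadratic functional in the theory of prime numbers I*, Rend.
  Mat. Acc. Lincei (9) 11 (2000), 183–233, §2. [Bombieri2000Weil]
* H. L. Montgomery, R. C. Vaughan, *Multiplicative Number Theory I*, Cambridge (2007), Thm. 10.17
  (the unit-window regrouping of a sum over zeros). [MontgomeryVaughan2007]
-/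

noncomputable section

open Complex Filter Set MeasureTheory

namespace Literature.NumberTheory.LFunctions

variable {g : ℝ → ℂ}

/-! ## Decay of every order -/

/-- **Decay of `ĝ` of every polynomial order on vertical strips**: for a test function `g`, a
half-width `A` and `k : ℕ` there is `D ≥ 0` with `‖ĝ(s)‖ ≤ D / (1 + (Im s)²)^k` whenever
`|Re s - 1/2| ≤ A` (induction on `k` via `(g'')^(s) = (s - 1/2)² ĝ(s)`, `(Im s)² ≤ |s - 1/2|²`,
from `norm_weilMellin_le_of_abs_re_le`). [cite: Bombieri2000Weil, §2] -/
theorem norm_weilMellin_le_pow_of_abs_re_le (hg : IsWeilTest g) (A : ℝ) (k : ℕ) :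
    ∃ D : ℝ, 0 ≤ D ∧ ∀ s : ℂ, |s.re - 1 / 2| ≤ A → ‖weilMellin g s‖ ≤ D / (1 + s.im ^ 2) ^ k := by
  induction k generalizing g with
  | zero =>
    refine ⟨weilDecayW A g, weilDecayW_nonneg _ _, fun s hs => ?_⟩
    rw [pow_zero, div_one]
    refine (norm_weilMellin_le_of_abs_re_le hg hs).trans (div_le_self (weilDecayW_nonneg _ _) ?_)
    nlinarith [sq_nonneg s.im]
  | succ k ih =>
    obtain ⟨D₁, hD₁, h₁⟩ := ih hg
    obtain ⟨D₂, hD₂, h₂⟩ := ih hg.deriv.deriv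
    refine ⟨D₁ + D₂, add_nonneg hD₁ hD₂, fun s hs => ?_⟩
    have hpos : 0 < 1 + s.im ^ 2 := by positivity
    have e₁ := h₁ s hs
    have e₂ := h₂ s hs
    rw [weilMellin_deriv_deriv hg, norm_mul, norm_pow] at e₂
    rw [le_div_iff₀ (pow_pos hpos _)] at e₁ e₂ ⊢
    have h3 : s.im ^ 2 ≤ ‖s - 1 / 2‖ ^ 2 := by
      have : |s.im| ≤ ‖s - 1 / 2‖ := by simpa using Complex.abs_im_le_norm (s - 1 / 2)
      nlinarith [abs_nonneg s.im, sq_abs s.im]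
    have h4 : 0 ≤ ‖weilMellin g s‖ * (1 + s.im ^ 2) ^ k := by positivity
    calc ‖weilMellin g s‖ * (1 + s.im ^ 2) ^ (k + 1)
        = ‖weilMellin g s‖ * (1 + s.im ^ 2) ^ k
            + s.im ^ 2 * (‖weilMellin g s‖ * (1 + s.im ^ 2) ^ k) := by ring
      _ ≤ D₁ + ‖s - 1 / 2‖ ^ 2 * (‖weilMellin g s‖ * (1 + s.im ^ 2) ^ k) :=
          add_le_add e₁ (mul_le_mul_of_nonneg_right h3 h4)
      _ = D₁ + ‖s - 1 / 2‖ ^ 2 * ‖weilMellin g s‖ * (1 + s.im ^ 2) ^ k := by ring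
      _ ≤ D₁ + D₂ := by linarith [e₂]

/-! ## Unit-window counts against polynomial decay -/

namespace WeilMellinPolyDecay

/-- `Σ_{m ∈ ℤ} 1/(1 + m²) < ∞` (comparison with the `p`-series `Σ 1/m²`,
Mathlib `Real.summable_one_div_int_pow`, plus the single term `m = 0`). [folklore] -/
theorem summable_inv_one_add_sq : Summable fun m : ℤ => (1 + (m : ℝ) ^ 2)⁻¹ := by
  have h2 : Summable fun m : ℤ => 1 / (m : ℝ) ^ 2 := Real.summable_one_div_int_pow.2 (by norm_num)
  have h0 : Summable fun m : ℤ => if m = 0 then (1 : ℝ) else 0 :=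
    summable_of_ne_finset_zero (s := {0}) fun m hm => by
      rw [Finset.mem_singleton] at hm
      rw [if_neg hm]
  refine Summable.of_nonneg_of_le (fun m => by positivity) (fun m => ?_) (h2.add h0)
  by_cases hm : m = 0
  · subst hm; simp
  · rw [if_neg hm, add_zero, inv_eq_one_div]
    have hm' : (0 : ℝ) < (m : ℝ) ^ 2 := by positivity
    exact one_div_le_one_div_of_le hm' (by linarith)

/-- `2 + |x| ≤ 3 (1 + x²)` for every real `x`. [folklore] -/
theorem two_add_abs_le (x : ℝ) : 2 + |x| ≤ 3 * (1 + x ^ 2) := by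
  nlinarith [abs_nonneg x, sq_abs x, sq_nonneg (|x| - 1 / 6)]

/-- If `|x - m| ≤ 1/2` then `1 + m² ≤ 4 (1 + x²)`. [folklore] -/
theorem one_add_sq_le_of_abs_sub_le {x m : ℝ} (h : |x - m| ≤ 1 / 2) :
    1 + m ^ 2 ≤ 4 * (1 + x ^ 2) := by
  have h2 : |m| ≤ |x| + 1 / 2 := by
    have := abs_sub_abs_le_abs_sub m x
    rw [abs_sub_comm] at this
    linarith
  have h3 : m ^ 2 ≤ (|x| + 1 / 2) ^ 2 := by
    rw [← sq_abs m]; exact pow_le_pow_left₀ (abs_nonneg _) h2 2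
  nlinarith [sq_nonneg (|x| - 1 / 2), sq_abs x, abs_nonneg x]

end WeilMellinPolyDecay

open WeilMellinPolyDecay in
/-- **Unit-window counts against polynomial decay.** Let `γ : ι → ℝ` have finitely many, and at
most `C (2 + |m|)^A`, indices in each unit window `|γ_i - m| ≤ 1` (`m ∈ ℤ`), and let
`0 ≤ F(i) ≤ D/(1 + γ_i²)^{k+1}` with `A ≤ k`, `0 ≤ D`. Then `Σ_i F(i)` converges: a finite partial
sum regrouped over the fibres of `m = round γ_i` (`|γ_i - m| ≤ 1/2`, so `1 + m² ≤ 4(1 + γ_i²)`)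
has fibre sums at most `C(2+|m|)^A · 4^{k+1} D/(1+m²)^{k+1} ≤ 3^k 4^{k+1} C D/(1+m²)`, and
`Σ_m 1/(1+m²) < ∞`. [cite: MontgomeryVaughan2007, Theorem 10.17 (the regrouping)] -/
theorem summable_of_unit_window_ncard_le {ι : Type*} (γ : ι → ℝ) {C A D : ℝ} {k : ℕ}
    (hAk : A ≤ k) (hD : 0 ≤ D)
    (hwin : ∀ m : ℤ, {i : ι | |γ i - m| ≤ 1}.Finite ∧
      (({i : ι | |γ i - m| ≤ 1}.ncard : ℕ) : ℝ) ≤ C * (2 + |(m : ℝ)|) ^ A)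
    {F : ι → ℝ} (hF0 : ∀ i, 0 ≤ F i) (hF : ∀ i, F i ≤ D / (1 + γ i ^ 2) ^ (k + 1)) :
    Summable F := by
  classical
  -- `0 ≤ C`, from the window `m = 0`
  have hC : 0 ≤ C := by
    have h := (hwin 0).2
    have hp : (0 : ℝ) < (2 + |((0 : ℤ) : ℝ)|) ^ A := Real.rpow_pos_of_pos (by positivity) _
    refine le_of_mul_le_mul_right ?_ hp
    rw [zero_mul]
    exact (Nat.cast_nonneg _).trans h
  -- the majorant `G m = C (2+|m|)^A · 4^{k+1} D/(1+m²)^{k+1}`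
  set G : ℤ → ℝ := fun m =>
    C * (2 + |(m : ℝ)|) ^ A * ((4 : ℝ) ^ (k + 1) * D / (1 + (m : ℝ) ^ 2) ^ (k + 1)) with hG
  have hG0 : ∀ m, 0 ≤ G m := fun m => by
    have : 0 ≤ (2 + |(m : ℝ)|) ^ A := Real.rpow_nonneg (by positivity) _
    positivity
  have hpoly : ∀ m : ℤ, (2 + |(m : ℝ)|) ^ A ≤ (3 : ℝ) ^ k * (1 + (m : ℝ) ^ 2) ^ k := fun m => by
    have h1 : (1 : ℝ) ≤ 2 + |(m : ℝ)| := by linarith [abs_nonneg (m : ℝ)]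
    calc (2 + |(m : ℝ)|) ^ A ≤ (2 + |(m : ℝ)|) ^ (k : ℝ) := Real.rpow_le_rpow_of_exponent_le h1 hAk
      _ = (2 + |(m : ℝ)|) ^ k := Real.rpow_natCast _ _
      _ ≤ (3 * (1 + (m : ℝ) ^ 2)) ^ k := pow_le_pow_left₀ (by positivity) (two_add_abs_le _) k
      _ = (3 : ℝ) ^ k * (1 + (m : ℝ) ^ 2) ^ k := mul_pow _ _ _
  have hGsum : Summable G := by
    refine Summable.of_nonneg_of_le hG0 (fun m => ?_)
      (summable_inv_one_add_sq.mul_left (C * 3 ^ k * (4 ^ (k + 1) * D)))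
    have hq : (0 : ℝ) < 1 + (m : ℝ) ^ 2 := by positivity
    calc G m = C * (2 + |(m : ℝ)|) ^ A * (4 ^ (k + 1) * D) / (1 + (m : ℝ) ^ 2) ^ (k + 1) := by
          rw [hG]; ring
      _ ≤ C * ((3 : ℝ) ^ k * (1 + (m : ℝ) ^ 2) ^ k) * (4 ^ (k + 1) * D)
            / (1 + (m : ℝ) ^ 2) ^ (k + 1) := by
          apply div_le_div_of_nonneg_right _ (by positivity)
          apply mul_le_mul_of_nonneg_right _ (by positivity)
          exact mul_le_mul_of_nonneg_left (hpoly m) hC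
      _ = C * 3 ^ k * (4 ^ (k + 1) * D) * (1 + (m : ℝ) ^ 2)⁻¹ := by
          rw [pow_succ]
          field_simp
          ring
  -- every finite partial sum is at most `Σ_m G m`
  refine summable_of_sum_le hF0 (c := ∑' m, G m) fun u => ?_
  rw [← Finset.sum_fiberwise_of_maps_to (g := fun i => round (γ i))
    (fun i _ => Finset.mem_image_of_mem (fun i => round (γ i)) ‹_›)]
  refine (Finset.sum_le_sum fun m _ => ?_).trans (hGsum.sum_le_tsum _ fun m _ => hG0 m)
  -- the fibre over `m`
  have hfib : ∀ i ∈ u.filter (fun i => round (γ i) = m), |γ i - m| ≤ 1 / 2 := fun i hi => by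
    have h : round (γ i) = m := (Finset.mem_filter.1 hi).2
    rw [← h]
    exact abs_sub_round _
  have hcard : (((u.filter fun i => round (γ i) = m).card : ℕ) : ℝ) ≤ C * (2 + |(m : ℝ)|) ^ A := by
    refine le_trans ?_ (hwin m).2
    have hsub : ((u.filter fun i => round (γ i) = m) : Set ι) ⊆ {i : ι | |γ i - m| ≤ 1} :=
      fun i hi => ((hfib i (Finset.mem_coe.1 hi)).trans (by norm_num))
    exact_mod_cast (Set.ncard_coe_finset _).symm.le.trans (Set.ncard_le_ncard hsub (hwin m).1)
  have hterm : ∀ i ∈ u.filter (fun i => round (γ i) = m),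
      F i ≤ (4 : ℝ) ^ (k + 1) * D / (1 + (m : ℝ) ^ 2) ^ (k + 1) := fun i hi => by
    have hden : 1 + (m : ℝ) ^ 2 ≤ 4 * (1 + γ i ^ 2) := one_add_sq_le_of_abs_sub_le (hfib i hi)
    refine (hF i).trans ?_
    rw [div_le_div_iff₀ (by positivity) (by positivity)]
    calc D * (1 + (m : ℝ) ^ 2) ^ (k + 1) ≤ D * (4 * (1 + γ i ^ 2)) ^ (k + 1) :=
          mul_le_mul_of_nonneg_left (pow_le_pow_left₀ (by positivity) hden _) hD
      _ = 4 ^ (k + 1) * D * (1 + γ i ^ 2) ^ (k + 1) := by rw [mul_pow]; ring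
  calc ∑ i ∈ u.filter (fun i => round (γ i) = m), F i
      ≤ ∑ i ∈ u.filter (fun i => round (γ i) = m),
          (4 : ℝ) ^ (k + 1) * D / (1 + (m : ℝ) ^ 2) ^ (k + 1) := Finset.sum_le_sum hterm
    _ = ((u.filter fun i => round (γ i) = m).card : ℝ)
          * ((4 : ℝ) ^ (k + 1) * D / (1 + (m : ℝ) ^ 2) ^ (k + 1)) := by
        rw [Finset.sum_const, nsmul_eq_mul]
    _ ≤ C * (2 + |(m : ℝ)|) ^ A * ((4 : ℝ) ^ (k + 1) * D / (1 + (m : ℝ) ^ 2) ^ (k + 1)) :=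
        mul_le_mul_of_nonneg_right hcard (by positivity)
    _ = G m := by rw [hG]

end Literature.NumberTheory.LFunctions

end
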